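import Mathlib
import HarnessLib
import Literature.Analysis.FluidPDE.VorticityCalculus
import Summits.NavierStokesRegularity.NavierStokesRegularity.Theorems.PoloidalWindowDoorPoloidalWindowRigidityWindow
import Summits.NavierStokesRegularity.NavierStokesRegularity.Theorems.PoloidalWindowDoorPoloidalWindowRigidityHotSplitRidgeKernels

/-!
# Route `PoloidalWindowDoor`, crux `PoloidalWindowRigidity` (stmt-NavierStokesRegularity-19708) — LINE 15 «hot_split» v1.6 (ns-idea-8 g8): R6 `hot_meets_every_circle` (the hot set
# meets every sphere about the hot spot) and R7 `planarArgmax_component_unbounded` (no bounded planar argmax component, any plane, any time, any sign)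

Cell ns-regularity-ideate, seat ns-poloidal-K2-p2 g13 (K2 hand).  Port to Theorems level of the two v1.6 additions of `Cruxes/PoloidalWindowRigidity/Lines/hot_split.lean`
(sorry-free there), statements VERBATIM with `Pinned`/`Peakless`/`hotSet` unfolded, proofs verbatim (credit ns-idea-8 g8), over R5 `…HotSplitRidgeKernels.hotComponent_unbounded` /
the Šura-Bura lemma `not_isBounded_connectedComponentIn` (p688999).

HONEST LABEL: structure of the hot/argmax sets of a pinned peakless class profile; no mathematics toward the residues C2a′/C2b′; 19708 / 20428 OPEN; NS regularity NOT proved.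
-/

noncomputable section

-- the summit and its single sub-problem share the name (CONVENTIONS §1), as in every Theorems file
set_option linter.dupNamespace false

namespace Summit.NavierStokesRegularity.NavierStokesRegularity.Theorems.PoloidalWindowDoorPoloidalWindowRigidityHotSplitRidgeGlobal

open Set Function MeasureTheory Filter Topology Metric
open scoped InnerProductSpace RealInnerProductSpace Laplacian
open Literature.Analysis Literature.Analysis.FluidPDE
open Summit.NavierStokesRegularity.NavierStokesRegularity.Theorems.PoloidalWindowDoorPoloidalWindowRigidityWindow
open Summit.NavierStokesRegularity.NavierStokesRegularity.Theorems.PoloidalWindowDoorPoloidalWindowRigidityHotSplitRidgeKernels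

/-- **R6 `hot_meets_every_circle` (v1.6, PROVED)** — the hot set meets EVERY circle of `P₀` centred at the hot spot: for each `R ≥ 0` there is a hot point
`y` with `‖y‖ = R` (the component of `0` in `H` is connected, contains `0`, and is unbounded (R5); the norm takes every value on it). -/
theorem hot_meets_every_circle {C : ℝ} {v : ℝ → EuclideanSpace ℝ (Fin 3) → EuclideanSpace ℝ (Fin 3)}
    (hP : (Literature.Analysis.FluidPDE.HasTypeITimeDecay C v ∧
        ContinuousOn (Function.uncurry v) (Set.Iio (0 : ℝ) ×ˢ Set.univ) ∧
        (∀ s t : ℝ, s < t → t < 0 → ∀ x, v t x =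
          Literature.Analysis.UnboundedOperators.heatExtension (v s) (t - s) x -
            Literature.Analysis.FluidPDE.oseenDuhamel 1 s v v t x) ∧
        (∀ t < 0, Literature.Analysis.FluidPDE.VectorCalculus.IsDivFree (v t)) ∧
        (∀ s < 0, ∀ y, ⟪Literature.Analysis.FluidPDE.curl (v s) y, EuclideanSpace.single 2 1⟫_ℝ = 0) ∧
        v (-1) 0 2 ≠ 0 ∧ (∀ t < 0, ∀ x, Real.sqrt (-t) * |v t x 2| ≤ |v (-1) 0 2|) ∧
        (∀ h : EuclideanSpace ℝ (Fin 3), fderiv ℝ (v (-1)) 0 h 2 = 0) ∧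
        (deriv (fun s => v s 0 2) (-1) = v (-1) 0 2 / 2 ∧ v (-1) 0 2 * (Δ (fun y => v (-1) y 2)) 0 ≤ 0)))
    (hPk : (∀ (s z₀ σ M : ℝ) (K O : Set (EuclideanSpace ℝ (Fin 3))), s < 0 →
        ((σ = 1 ∨ σ = -1) ∧ IsCompact K ∧ K.Nonempty ∧ (∀ y ∈ K, y 2 = z₀ ∧ σ * v s y 2 = M) ∧
          IsOpen O ∧ K ⊆ O ∧ (∀ y ∈ O, y 2 = z₀ → σ * v s y 2 ≤ M) ∧
          (∀ y ∈ O, y 2 = z₀ → σ * v s y 2 = M → y ∈ K)) → False)) (R : ℝ) (hR : 0 ≤ R) :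
    ∃ y ∈ {y : EuclideanSpace ℝ (Fin 3) | y 2 = 0 ∧ v (-1) y 2 = v (-1) 0 2}, ‖y‖ = R := by
  have h0 : (0 : EuclideanSpace ℝ (Fin 3)) ∈ {y : EuclideanSpace ℝ (Fin 3) | y 2 = 0 ∧ v (-1) y 2 = v (-1) 0 2} := ⟨rfl, rfl⟩
  set S := connectedComponentIn ({y : EuclideanSpace ℝ (Fin 3) | y 2 = 0 ∧ v (-1) y 2 = v (-1) 0 2}) (0 : EuclideanSpace ℝ (Fin 3)) with hS
  have hunb : ¬ Bornology.IsBounded S := hotComponent_unbounded C v hP hPk 0 h0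
  -- a point of the component with norm `> R`
  obtain ⟨z, hzS, hzR⟩ : ∃ z ∈ S, R < ‖z‖ := by
    by_contra h
    push Not at h
    apply hunb
    refine (Metric.isBounded_iff_subset_closedBall (0 : EuclideanSpace ℝ (Fin 3))).2 ⟨R, fun z hz => ?_⟩
    rw [mem_closedBall, dist_zero_right]; exact h z hz
  -- intermediate value of the norm on the preconnected `S` between `0` and `z`
  have hpre : IsPreconnected S := isPreconnected_connectedComponentIn
  have h0S : (0 : EuclideanSpace ℝ (Fin 3)) ∈ S := mem_connectedComponentIn h0
  have hIcc := hpre.intermediate_value h0S hzS (continuous_norm.continuousOn)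
  have hRmem : R ∈ Icc ‖(0 : EuclideanSpace ℝ (Fin 3))‖ ‖z‖ := by
    rw [norm_zero]; exact ⟨hR, hzR.le⟩
  obtain ⟨y, hyS, hyR⟩ := hIcc hRmem
  exact ⟨y, connectedComponentIn_subset _ _ hyS, hyR⟩

/-- **R7 `planarArgmax_component_unbounded` (v1.6, PROVED)** — NO BOUNDED PLANAR EXTREMAL COMPONENTS, ANY PLANE, ANY TIME: in the pinned peakless class, if
`σ·v₂(s,·)` (`σ = ±1`, `s < 0`) attains its maximum over the horizontal plane `P_{z₀}` at `y₀`, then the connected component of `y₀` in the planar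
argmax set `{y ∈ P_{z₀} : v₂(s,y) = v₂(s,y₀)}` is UNBOUNDED.  (R5 is the case `s = −1`, `z₀ = 0`, level `N`.) -/
theorem planarArgmax_component_unbounded {C : ℝ} {v : ℝ → EuclideanSpace ℝ (Fin 3) → EuclideanSpace ℝ (Fin 3)}
    (hP : (Literature.Analysis.FluidPDE.HasTypeITimeDecay C v ∧
        ContinuousOn (Function.uncurry v) (Set.Iio (0 : ℝ) ×ˢ Set.univ) ∧
        (∀ s t : ℝ, s < t → t < 0 → ∀ x, v t x =
          Literature.Analysis.UnboundedOperators.heatExtension (v s) (t - s) x -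
            Literature.Analysis.FluidPDE.oseenDuhamel 1 s v v t x) ∧
        (∀ t < 0, Literature.Analysis.FluidPDE.VectorCalculus.IsDivFree (v t)) ∧
        (∀ s < 0, ∀ y, ⟪Literature.Analysis.FluidPDE.curl (v s) y, EuclideanSpace.single 2 1⟫_ℝ = 0) ∧
        v (-1) 0 2 ≠ 0 ∧ (∀ t < 0, ∀ x, Real.sqrt (-t) * |v t x 2| ≤ |v (-1) 0 2|) ∧
        (∀ h : EuclideanSpace ℝ (Fin 3), fderiv ℝ (v (-1)) 0 h 2 = 0) ∧
        (deriv (fun s => v s 0 2) (-1) = v (-1) 0 2 / 2 ∧ v (-1) 0 2 * (Δ (fun y => v (-1) y 2)) 0 ≤ 0)))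
    (hPk : (∀ (s z₀ σ M : ℝ) (K O : Set (EuclideanSpace ℝ (Fin 3))), s < 0 →
        ((σ = 1 ∨ σ = -1) ∧ IsCompact K ∧ K.Nonempty ∧ (∀ y ∈ K, y 2 = z₀ ∧ σ * v s y 2 = M) ∧
          IsOpen O ∧ K ⊆ O ∧ (∀ y ∈ O, y 2 = z₀ → σ * v s y 2 ≤ M) ∧
          (∀ y ∈ O, y 2 = z₀ → σ * v s y 2 = M → y ∈ K)) → False)) {s z₀ σ : ℝ} (hs : s < 0) (hσ : σ = 1 ∨ σ = -1)
    {y₀ : EuclideanSpace ℝ (Fin 3)} (hy₀ : y₀ 2 = z₀) (hmax : ∀ y : EuclideanSpace ℝ (Fin 3), y 2 = z₀ → σ * v s y 2 ≤ σ * v s y₀ 2) :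
    ¬ Bornology.IsBounded (connectedComponentIn {y : EuclideanSpace ℝ (Fin 3) | y 2 = z₀ ∧ v s y 2 = v s y₀ 2} y₀) := by
  obtain ⟨hrate, hcont, hmild, hdiv, -, -, -, -, -⟩ := hP
  have hA : IsTypeIAncientMild C v := isTypeIAncientMild_of_class hrate hcont hmild hdiv
  have hvs : ContDiff ℝ (⊤ : ℕ∞) (v s) := hA.contDiff_slice hs
  have hv2 : ContDiff ℝ 2 (v s) := contDiff_infty.1 hvs 2
  have hwcont : Continuous fun y => v s y 2 := (contDiff_apply_coord_vec3 hv2 2).continuous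
  have hcoord : Continuous fun y : EuclideanSpace ℝ (Fin 3) => y 2 := by
    simpa using (EuclideanSpace.proj (𝕜 := ℝ) (2 : Fin 3)).continuous
  set H : Set (EuclideanSpace ℝ (Fin 3)) := {y | y 2 = z₀ ∧ v s y 2 = v s y₀ 2} with hH
  have hHc : IsClosed H := by
    have h1 : IsClosed {y : EuclideanSpace ℝ (Fin 3) | y 2 = z₀} := isClosed_eq hcoord continuous_const
    have h2 : IsClosed {y : EuclideanSpace ℝ (Fin 3) | v s y 2 = v s y₀ 2} := isClosed_eq hwcont continuous_const
    have hset : H = {y : EuclideanSpace ℝ (Fin 3) | y 2 = z₀} ∩ {y | v s y 2 = v s y₀ 2} := by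
      ext y; simp [hH]
    rw [hset]; exact h1.inter h2
  have hσne : σ ≠ 0 := by rcases hσ with h | h <;> simp [h]
  have hno : ∀ K O : Set (EuclideanSpace ℝ (Fin 3)), IsCompact K → K.Nonempty → K ⊆ H → IsOpen O → K ⊆ O →
      O ∩ H ⊆ K → False := by
    intro K O hK hKne hKH hO hKO hOH
    apply hPk s z₀ σ (σ * v s y₀ 2) K O hs
    refine ⟨hσ, hK, hKne, ?_, hO, hKO, ?_, ?_⟩
    · intro y hy
      obtain ⟨hy1, hy2⟩ := hKH hy
      exact ⟨hy1, by rw [hy2]⟩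
    · intro y _ hyz
      exact hmax y hyz
    · intro y hyO hyz hyM
      apply hOH
      exact ⟨hyO, hyz, mul_left_cancel₀ hσne hyM⟩
  exact not_isBounded_connectedComponentIn hHc hno ⟨hy₀, rfl⟩

end Summit.NavierStokesRegularity.NavierStokesRegularity.Theorems.PoloidalWindowDoorPoloidalWindowRigidityHotSplitRidgeGlobal

end
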